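import Summits.ValiantsHypothesis.ValiantsHypothesis.Theorems.PolyaContinuedLaplaceRigiditySingGenericPoint
import Summits.ValiantsHypothesis.ValiantsHypothesis.Theorems.PolyaContinuedLaplaceRigiditySingCodimEight
import Literature.Computability.AlgebraicComplexity.PermanentIrreducible

/-!
# Top-dimensional components of `Sing(per₄)` with two zero lines: types (L) and (X)

Helper file for crux `CoverDecancellation` (stmt-ValiantsHypothesis-17819), line `laplace_rigidity`,
rung row R3 at width 4 (`str₂(per₄) ≥ 5`), read against val-idea-10 g3's line «component_rigidity»
(stub B `TopPrimeRigidity`).  A height-`8` prime `P` over the `3 × 3` sub-permanents of the generic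
`4 × 4` matrix contains a full row or a full column of variables (`…SingTopZeroLine`); this file
settles the two cases in which it contains a SECOND line, by generic-point arguments and WITHOUT
classifying components:

* **`eq_span_X_of_height_le_eight`** (type (L), both two rows and two columns at once): a prime of
  `F[X_{4×4}]` of height `≤ 8` containing the eight variables of a set `S` with `|Sᶜ| = 8` IS the
  ideal `(X_e : e ∈ S)` — a polynomial of `P` free of the `S`-variables would be a relation among the
  eight remaining coordinates of the generic point, forcing `trdeg ≤ 7`, `height ≥ 9`;
  corollaries `eq_span_X_twoRows`, `eq_span_X_twoCols`.
* **`quadric_mem_span_rowCol`** (type (X)): if `P ⊇ subpermIdeal F 4 4 3` has height `≤ 8` and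
  contains row `i` and column `c`, then every homogeneous quadric of `P` lies in the ideal of the
  variables of row `i ∪` column `c`.  Proof: the complementary `3 × 3` block `z_T` of the generic
  point has `trdeg_F F[z_T] ≥ 8` and `per₃(z_T) = 0`, so the kernel of `f ↦ f(z_T)` is a height-`≤ 1`
  prime containing the prime `per₃` (tree: `perPoly_irreducible`, von zur Gathen), hence equals
  `(per₃)`; the `T`-part of a quadric of `P` is then a multiple of `per₃` of degree `2 < 3`, i.e. zero.

Consumer shape (stub B of `Lines/component_rigidity.lean`, with `cellIdeal`/`rowCol`/`twoRows`/
`twoCols` UNFOLDED): `P = Ideal.span (X '' {e | e.1 = i ∨ e.1 = i'})` etc., and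
`∀ f ∈ P, f.IsHomogeneous 2 → f ∈ Ideal.span (X '' {e | e.1 = i ∨ e.2 = c})`.

Honest framing: structure lemmas about `Sing(per₄)`; the remaining case of stub B (exactly one zero
line — Kirkup's non-degenerate prime `J₃`, `(J₃)_{≤ 2} = 0`) is NOT done here; `str₂(per₄) ≥ 5`,
`StrengthTwoPerFour` (stmt-25160), `CentralLaplaceRigidity`, `CoverDecancellation` and VP ≠ VNP are
OPEN and NOT moved; no summit statement is touched.  val-width-17819-w1 g2, 2026-08-28.

References: G. Kirkup, *Minimal primes over permanental ideals*, Trans. AMS 360 (2008) 3751–3770,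
Thm. 14 (types (1) and (3)) [Kirkup2005]; J. von zur Gathen, Linear Algebra Appl. 96 (1987), Thm. 3.4
[Vonzurgathen1987]; J. Alper, T. Bogart, M. Velasco, Found. Comput. Math. 17 (2017), Rem. 1.5
[AlperBogartVelasco2017].
-/

set_option linter.dupNamespace false

noncomputable section

namespace Summit.ValiantsHypothesis.ValiantsHypothesis.Theorems.PolyaContinuedLaplaceRigidity.SingCodim

open MvPolynomial Cardinal Matrix
open Literature.Computability.AlgebraicComplexity
open Literature.Computability.AlgebraicComplexity.BoraleviCarliniMichalekVentura2025

variable {F : Type*} [Field F] {L : Type*} [Field L] [Algebra F L]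

/-! ### Type (L): a height-`8` prime containing eight variables is their ideal -/

/-- **Type (L).**  A prime `P` of `F[X_{4×4}]` of height `≤ 8` containing the variables of a set `S`
of cells with `|Sᶜ| = 8` equals the ideal `(X_e : e ∈ S)`.  (Generic point: a polynomial of `P`
free of the `S`-variables is a relation among the eight other coordinates, so `trdeg ≤ 7` and
`height ≥ 9`.) [cite: Kirkup2005, Thm. 14 (type (1))] -/
theorem eq_span_X_of_height_le_eight (F : Type*) [Field F] (S : Finset (Fin 4 × Fin 4))
    (hS : Sᶜ.card = 8) (P : Ideal (MvPolynomial (Fin 4 × Fin 4) F)) [P.IsPrime]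
    (h8 : P.height ≤ 8) (hSP : ∀ e ∈ S, (X e : MvPolynomial (Fin 4 × Fin 4) F) ∈ P) :
    P = Ideal.span ((fun e => (X e : MvPolynomial (Fin 4 × Fin 4) F)) '' (S : Set (Fin 4 × Fin 4))) := by
  classical
  refine le_antisymm ?_ (Ideal.span_le.2 ?_)
  swap
  · rintro _ ⟨e, he, rfl⟩
    exact hSP e (Finset.mem_coe.1 he)
  intro f hf
  -- the generic point
  set Lf := FractionRing (MvPolynomial (Fin 4 × Fin 4) F ⧸ P)
  set z : Fin 4 × Fin 4 → Lf := fun x =>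
    algebraMap (MvPolynomial (Fin 4 × Fin 4) F ⧸ P) Lf (Ideal.Quotient.mk P (X x)) with hz
  have hker : RingHom.ker (aeval (R := F) z) = P := ker_aeval_quotient_mk_X P
  have hzS : ∀ e ∈ S, z e = 0 := by
    intro e he
    have h := hSP e he
    rw [← hker, RingHom.mem_ker, aeval_X] at h
    exact h
  -- the eight remaining cells
  set T : Finset (Fin 4 × Fin 4) := Sᶜ with hT
  set emb : Fin 8 → Fin 4 × Fin 4 := fun k => ((T.equivFin.symm (Fin.cast hS.symm k) : T) :
    Fin 4 × Fin 4) with hemb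
  have hemb_inj : Function.Injective emb := by
    intro a b hab
    have h := Subtype.ext hab
    rw [Equiv.apply_eq_iff_eq] at h
    exact (Fin.cast_injective _) h
  have hemb_mem : ∀ k, emb k ∈ T := fun k => (T.equivFin.symm (Fin.cast hS.symm k)).2
  have hemb_range : ∀ e, e ∉ S → e ∈ Set.range emb := by
    intro e he
    have heT : e ∈ T := by rw [hT, Finset.mem_compl]; exact he
    refine ⟨Fin.cast hS (T.equivFin ⟨e, heT⟩), ?_⟩
    simp [hemb]
  -- split `f` off the `S`-variables
  obtain ⟨g, r, hfgr, hr, hgvars, -⟩ := exists_split_off_vars (F := F) (S : Set (Fin 4 × Fin 4)) f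
  have hspan_le : Ideal.span ((fun e => (X e : MvPolynomial (Fin 4 × Fin 4) F)) ''
      (S : Set (Fin 4 × Fin 4))) ≤ P := by
    rw [Ideal.span_le]
    rintro _ ⟨e, he, rfl⟩
    exact hSP e (Finset.mem_coe.1 he)
  have hgP : g ∈ P := by
    have : g = f - r := by rw [hfgr]; ring
    rw [this]
    exact P.sub_mem hf (hspan_le hr)
  -- `g` is a polynomial in the `T`-variables
  have hgT : (↑g.vars : Set (Fin 4 × Fin 4)) ⊆ Set.range emb := by
    intro e he
    exact hemb_range e (hgvars he)
  obtain ⟨q, hq⟩ := exists_rename_eq_of_vars_subset_range g emb hemb_inj hgT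
  by_cases hq0 : q = 0
  · rw [hq0, map_zero] at hq
    rw [hfgr, ← hq, zero_add]
    exact hr
  · -- a non-trivial relation among the eight `T`-coordinates: `trdeg ≤ 7`, `height ≥ 9`
    exfalso
    have hrel : aeval (z ∘ emb) q = 0 := by
      rw [← aeval_rename, hq]
      have := hgP
      rw [← hker, RingHom.mem_ker] at this
      exact this
    have h7 : Algebra.trdeg F (Algebra.adjoin F (Set.range (z ∘ emb))) ≤ (7 : ℕ) := by
      simpa using trdeg_adjoin_range_le_of_aeval_eq_zero_fintype (F := F) (z ∘ emb) hq0 hrel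
    have h7' : Algebra.trdeg F (Algebra.adjoin F (Set.range z)) ≤ (7 : ℕ) := by
      refine le_trans (trdeg_adjoin_le_trdeg_of_forall_alg fun x hx => ?_) h7
      obtain ⟨e, rfl⟩ := hx
      by_cases he : e ∈ S
      · exact alg_of_eq_zero _ (hzS e he)
      · obtain ⟨k, hk⟩ := hemb_range e he
        exact alg_of_mem ⟨k, by rw [Function.comp_apply, hk]⟩
    have hh : (RingHom.ker (aeval (R := F) z)).height ≤ 8 := by rw [hker]; exact h8
    have := card_le_of_trdeg_le_of_height_le (F := F) z h7' hh
    simp at this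

/-- The two rows `i ≠ i'` leave eight cells. -/
theorem card_compl_twoRows (i i' : Fin 4) (h : i ≠ i') :
    (Finset.univ.filter fun e : Fin 4 × Fin 4 => e.1 = i ∨ e.1 = i')ᶜ.card = 8 := by
  revert i i'; decide

/-- The two columns `j ≠ j'` leave eight cells. -/
theorem card_compl_twoCols (j j' : Fin 4) (h : j ≠ j') :
    (Finset.univ.filter fun e : Fin 4 × Fin 4 => e.2 = j ∨ e.2 = j')ᶜ.card = 8 := by
  revert j j'; decide

/-- **Type (L), rows**: a prime of height `≤ 8` containing two rows of variables is their ideal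
(the form of `TopPrimeRigidity`'s clause `P = cellIdeal (twoRows i i')`, unfolded).
[cite: Kirkup2005, Thm. 14 (type (1))] -/
theorem eq_span_X_twoRows (F : Type*) [Field F] {i i' : Fin 4} (hii' : i ≠ i')
    (P : Ideal (MvPolynomial (Fin 4 × Fin 4) F)) [P.IsPrime] (h8 : P.height ≤ 8)
    (hi : ∀ j, (X (i, j) : MvPolynomial (Fin 4 × Fin 4) F) ∈ P)
    (hi' : ∀ j, (X (i', j) : MvPolynomial (Fin 4 × Fin 4) F) ∈ P) :
    P = Ideal.span ((fun e => (X e : MvPolynomial (Fin 4 × Fin 4) F)) ''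
      ((Finset.univ.filter fun e : Fin 4 × Fin 4 => e.1 = i ∨ e.1 = i') : Set (Fin 4 × Fin 4))) := by
  refine eq_span_X_of_height_le_eight F _ (card_compl_twoRows i i' hii') P h8 ?_
  intro e he
  rw [Finset.mem_filter] at he
  rcases he.2 with h | h
  · have := hi e.2; rwa [← h] at this
  · have := hi' e.2; rwa [← h] at this

/-- **Type (L), columns**: a prime of height `≤ 8` containing two columns of variables is their
ideal. [cite: Kirkup2005, Thm. 14 (type (1))] -/
theorem eq_span_X_twoCols (F : Type*) [Field F] {j j' : Fin 4} (hjj' : j ≠ j')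
    (P : Ideal (MvPolynomial (Fin 4 × Fin 4) F)) [P.IsPrime] (h8 : P.height ≤ 8)
    (hj : ∀ i, (X (i, j) : MvPolynomial (Fin 4 × Fin 4) F) ∈ P)
    (hj' : ∀ i, (X (i, j') : MvPolynomial (Fin 4 × Fin 4) F) ∈ P) :
    P = Ideal.span ((fun e => (X e : MvPolynomial (Fin 4 × Fin 4) F)) ''
      ((Finset.univ.filter fun e : Fin 4 × Fin 4 => e.2 = j ∨ e.2 = j') : Set (Fin 4 × Fin 4))) := by
  refine eq_span_X_of_height_le_eight F _ (card_compl_twoCols j j' hjj') P h8 ?_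
  intro e he
  rw [Finset.mem_filter] at he
  rcases he.2 with h | h
  · have := hj e.1; rwa [← h] at this
  · have := hj' e.1; rwa [← h] at this

/-! ### Type (X): a zero row and a zero column -/

/-- `per₃` is a non-zero polynomial. [folklore] -/
theorem perPoly_three_ne_zero : perPoly (Fin 3) F ≠ 0 := by
  intro h
  have := coeff_permMonomial_perPoly (n := Fin 3) F (Equiv.refl _)
  rw [h, coeff_zero] at this
  exact zero_ne_one this

/-- `per₃` has total degree `3`. [folklore] -/
theorem totalDegree_perPoly_three : (perPoly (Fin 3) F).totalDegree = 3 := by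
  simpa using (perPoly_isHomogeneous (n := Fin 3) (k := F)).totalDegree perPoly_three_ne_zero

/-- **A degree count**: a non-zero multiple of `per₃` has total degree `≥ 3`; so a homogeneous
quadric divisible by `per₃` vanishes. [folklore] -/
theorem eq_zero_of_perPoly_three_dvd {q : MvPolynomial (Fin 3 × Fin 3) F} (hq : q.IsHomogeneous 2)
    (hdvd : perPoly (Fin 3) F ∣ q) : q = 0 := by
  by_contra hq0
  obtain ⟨t, rfl⟩ := hdvd
  have ht0 : t ≠ 0 := fun h => hq0 (by rw [h, mul_zero])
  have h2 := hq.totalDegree hq0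
  rw [totalDegree_mul_of_isDomain perPoly_three_ne_zero ht0, totalDegree_perPoly_three] at h2
  omega

/-- **A generic point of the cubic `per₃ = 0` only satisfies multiples of `per₃`.**  If
`w : Fin 3 × Fin 3 → L` has `per₃(w) = 0` and `trdeg_F F[w] ≥ 8`, then the kernel of `f ↦ f(w)`
is the principal prime `(per₃)`. [cite: Vonzurgathen1987, Thm. 3.4] -/
theorem ker_aeval_eq_span_perPoly_three (w : Fin 3 × Fin 3 → L)
    (hw : aeval w (perPoly (Fin 3) F) = 0)
    (h8 : (8 : Cardinal) ≤ Algebra.trdeg F (Algebra.adjoin F (Set.range w))) :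
    RingHom.ker (aeval (R := F) w) = Ideal.span {perPoly (Fin 3) F} := by
  -- the principal prime `(per₃)` of height `≥ 1`
  have hprime : (Ideal.span {perPoly (Fin 3) F}).IsPrime :=
    (Ideal.span_singleton_prime perPoly_three_ne_zero).2
      (UniqueFactorizationMonoid.irreducible_iff_prime.mp perPoly_irreducible)
  haveI := hprime
  have h1 : 1 ≤ (Ideal.span {perPoly (Fin 3) F}).height :=
    Ideal.one_le_height_span_singleton_of_mem_nonZeroDivisors
      (mem_nonZeroDivisors_of_ne_zero perPoly_three_ne_zero)
  have hle : Ideal.span {perPoly (Fin 3) F} ≤ RingHom.ker (aeval (R := F) w) := by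
    rw [Ideal.span_singleton_le_iff_mem, RingHom.mem_ker]
    exact hw
  -- the kernel has height `≤ 1` by the two-sided bridge
  obtain ⟨m, hm, hsum⟩ := exists_height_ker_aeval_eq_add (F := F) w
  have htr : 8 ≤ Cardinal.toNat (Algebra.trdeg F (Algebra.adjoin F (Set.range w))) := by
    have := Cardinal.toNat_le_toNat h8 (trdeg_adjoin_range_lt_aleph0 w)
    simpa using this
  have hcard : Fintype.card (Fin 3 × Fin 3) = 9 := by simp
  have hm1 : m ≤ 1 := by omega
  haveI : (RingHom.ker (aeval (R := F) w)).IsPrime := RingHom.ker_isPrime _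
  refine (Ideal.eq_of_le_of_height_le (Ideal.span {perPoly (Fin 3) F}) hle ?_).symm
  rw [hm]
  exact le_trans (by exact_mod_cast hm1) h1

/-- The nine cells off row `i` and column `c`. -/
theorem exists_eq_succAbove_pair {i c : Fin 4} {e : Fin 4 × Fin 4} (he : ¬ (e.1 = i ∨ e.2 = c)) :
    ∃ ab : Fin 3 × Fin 3, (i.succAbove ab.1, c.succAbove ab.2) = e := by
  push Not at he
  obtain ⟨a, ha⟩ := Fin.exists_succAbove_eq he.1
  obtain ⟨b, hb⟩ := Fin.exists_succAbove_eq he.2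
  exact ⟨(a, b), by rw [ha, hb]⟩

/-- **Type (X).**  Let `P ⊇ subpermIdeal F 4 4 3` be a prime of height `≤ 8` containing the variables
of row `i` and of column `c`.  Then every homogeneous quadric of `P` lies in the ideal of the variables
of row `i ∪` column `c` (the form of `TopPrimeRigidity`'s first clause with `cellIdeal (rowCol i c)`
unfolded).  The complementary `3 × 3` block of the generic point is a generic point of `per₃ = 0`
(`ker_aeval_eq_span_perPoly_three`), and a quadric multiple of `per₃` is zero.
[cite: Kirkup2005, Thm. 14 (type (3))] -/
theorem quadric_mem_span_rowCol (F : Type*) [Field F] (i c : Fin 4)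
    (P : Ideal (MvPolynomial (Fin 4 × Fin 4) F)) [P.IsPrime]
    (hle : subpermIdeal F 4 4 3 ≤ P) (h8 : P.height ≤ 8)
    (hrow : ∀ j, (X (i, j) : MvPolynomial (Fin 4 × Fin 4) F) ∈ P)
    (hcol : ∀ j, (X (j, c) : MvPolynomial (Fin 4 × Fin 4) F) ∈ P)
    (f : MvPolynomial (Fin 4 × Fin 4) F) (hf : f ∈ P) (hhom : f.IsHomogeneous 2) :
    f ∈ Ideal.span ((fun e => (X e : MvPolynomial (Fin 4 × Fin 4) F)) ''
      ((Finset.univ.filter fun e : Fin 4 × Fin 4 => e.1 = i ∨ e.2 = c) : Set (Fin 4 × Fin 4))) := by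
  classical
  -- the generic point
  set Lf := FractionRing (MvPolynomial (Fin 4 × Fin 4) F ⧸ P)
  set z : Fin 4 × Fin 4 → Lf := fun x =>
    algebraMap (MvPolynomial (Fin 4 × Fin 4) F ⧸ P) Lf (Ideal.Quotient.mk P (X x)) with hz
  have hker : RingHom.ker (aeval (R := F) z) = P := ker_aeval_quotient_mk_X P
  have hzrow : ∀ j, z (i, j) = 0 := by
    intro j
    have h := hrow j
    rw [← hker, RingHom.mem_ker, aeval_X] at h
    exact h
  have hzcol : ∀ j, z (j, c) = 0 := by
    intro j
    have h := hcol j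
    rw [← hker, RingHom.mem_ker, aeval_X] at h
    exact h
  -- the complementary `3 × 3` block
  set emb : Fin 3 × Fin 3 → Fin 4 × Fin 4 := fun ab => (i.succAbove ab.1, c.succAbove ab.2)
    with hemb
  have hemb_inj : Function.Injective emb := by
    rintro ⟨a, b⟩ ⟨a', b'⟩ h
    simp only [hemb, Prod.mk.injEq] at h
    rw [Fin.succAbove_right_injective h.1, Fin.succAbove_right_injective h.2]
  set w : Fin 3 × Fin 3 → Lf := z ∘ emb with hw
  -- `per₃(w) = 0`: the sub-permanent avoiding row `i` and column `c` lies in `P`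
  have hperw : aeval w (perPoly (Fin 3) F) = 0 := by
    have h1 : aeval w (perPoly (Fin 3) F) =
        (Matrix.of fun a b : Fin 3 => z (i.succAbove a, c.succAbove b)).permanent := by
      simp [perPoly, Matrix.permanent, map_sum, map_prod, Matrix.mvPolynomialX, hw, hemb]
    rw [h1]
    obtain ⟨j, k, l, hij, hik, hil, hjk, hjl, hkl⟩ := exists_three_others i
    obtain ⟨b, c', d, hcb, hcc, hcd', hbc, hbd, hcd⟩ := exists_three_others c
    set M : Matrix (Fin 4) (Fin 4) Lf := Matrix.of fun a b => z (a, b) with hM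
    have hsub : (Matrix.of fun a b : Fin 3 => z (i.succAbove a, c.succAbove b)) =
        M.submatrix i.succAbove c.succAbove := by
      ext a b; simp [hM]
    rw [hsub, permanent_submatrix_succAbove_eq M hij hik hil hjk hjl hkl hcb hcc hcd' hbc hbd hcd]
    have hRc : ({j, k, l} : Finset (Fin 4)).card = 3 := by
      rw [Finset.card_insert_of_notMem (by simp [hjk, hjl]), Finset.card_pair hkl]
    have hCc : ({b, c', d} : Finset (Fin 4)).card = 3 := by
      rw [Finset.card_insert_of_notMem (by simp [hbc, hbd]), Finset.card_pair hcd]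
    have hmem : rsubperm (mvPolynomialX (Fin 4) (Fin 4) F) (· ∈ ({b, c', d} : Finset (Fin 4)))
        (· ∈ ({j, k, l} : Finset (Fin 4))) ∈ P :=
      hle (rsubperm_mem_subpermIdeal hRc hCc)
    rw [← hker, RingHom.mem_ker, aeval_rsubperm_X,
      AlperBogartVelasco.rsubperm_triple _ hjk hjl hkl hbc hbd hcd] at hmem
    simpa only [hM, Matrix.of_apply] using hmem
  -- `trdeg F[w] ≥ 8`: the sixteen coordinates are algebraic over the nine, and `height P ≤ 8`
  have h8z : ((Fintype.card (Fin 4 × Fin 4) - 8 : ℕ) : Cardinal) ≤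
      Algebra.trdeg F (Algebra.adjoin F (Set.range z)) :=
    natCast_le_trdeg_of_height_ker_aeval_le (F := F) z (by rw [hker]; exact h8)
  have h8w : (8 : Cardinal) ≤ Algebra.trdeg F (Algebra.adjoin F (Set.range w)) := by
    refine le_trans (by simpa using h8z) (trdeg_adjoin_le_trdeg_of_forall_alg fun x hx => ?_)
    obtain ⟨e, rfl⟩ := hx
    by_cases he : e.1 = i ∨ e.2 = c
    · refine alg_of_eq_zero _ ?_
      rcases he with h | h
      · have := hzrow e.2; rwa [← h] at this
      · have := hzcol e.1; rwa [← h] at this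
    · obtain ⟨ab, hab⟩ := exists_eq_succAbove_pair he
      exact alg_of_mem ⟨ab, by rw [← hab]; rfl⟩
  have hkerw : RingHom.ker (aeval (R := F) w) = Ideal.span {perPoly (Fin 3) F} :=
    ker_aeval_eq_span_perPoly_three w hperw h8w
  -- split `f` off the row/column variables
  set S : Finset (Fin 4 × Fin 4) := Finset.univ.filter fun e : Fin 4 × Fin 4 => e.1 = i ∨ e.2 = c
    with hS
  obtain ⟨g, r, hfgr, hr, hgvars, hgsupp⟩ :=
    exists_split_off_vars (F := F) (S : Set (Fin 4 × Fin 4)) f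
  have hspan_le : Ideal.span ((fun e => (X e : MvPolynomial (Fin 4 × Fin 4) F)) ''
      (S : Set (Fin 4 × Fin 4))) ≤ P := by
    rw [Ideal.span_le]
    rintro _ ⟨e, he, rfl⟩
    rw [Finset.mem_coe, hS, Finset.mem_filter] at he
    rcases he.2 with h | h
    · have := hrow e.2; rwa [← h] at this
    · have := hcol e.1; rwa [← h] at this
  have hgP : g ∈ P := by
    have : g = f - r := by rw [hfgr]; ring
    rw [this]
    exact P.sub_mem hf (hspan_le hr)
  have hghom : g.IsHomogeneous 2 := isHomogeneous_of_support_subset hhom hgsupp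
  have hgT : (↑g.vars : Set (Fin 4 × Fin 4)) ⊆ Set.range emb := by
    intro e he
    have heS : e ∉ (S : Set (Fin 4 × Fin 4)) := hgvars he
    rw [Finset.mem_coe, hS, Finset.mem_filter, not_and] at heS
    obtain ⟨ab, hab⟩ := exists_eq_succAbove_pair (heS (Finset.mem_univ e))
    exact ⟨ab, hab⟩
  obtain ⟨q, hq, hqhom⟩ :=
    exists_rename_eq_of_vars_subset_range_isHomogeneous g emb hemb_inj hgT hghom
  -- `q(w) = g(z) = 0`, so `per₃ ∣ q`, so `q = 0`
  have hqker : q ∈ RingHom.ker (aeval (R := F) w) := by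
    rw [RingHom.mem_ker, hw, ← aeval_rename, hq]
    have := hgP
    rw [← hker, RingHom.mem_ker] at this
    exact this
  rw [hkerw, Ideal.mem_span_singleton] at hqker
  have hq0 : q = 0 := eq_zero_of_perPoly_three_dvd hqhom hqker
  rw [hq0, map_zero] at hq
  rw [hfgr, ← hq, zero_add]
  exact hr

end Summit.ValiantsHypothesis.ValiantsHypothesis.Theorems.PolyaContinuedLaplaceRigidity.SingCodim

end
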